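import Literature.AlgebraicGeometry.Motives.MiddleConvolution
import Mathlib.Algebra.Algebra.Subalgebra.Basic
import Mathlib.FieldTheory.IsAlgClosed.Basic
import HarnessLib

/-!
# Rigid tuples: Katz's index of rigidity, linear (= physical) rigidity, and Katz's existence
# algorithm, in the Dettweiler–Reiter tuple model

Topic `Literature/AlgebraicGeometry/Motives`.  Katz (*Rigid Local Systems*, 1996 [Katz1996]) calls a
local system `𝓕` on `U = ℙ¹ ∖ {s₁,…,s_r}` **physically rigid** if it is determined up to isomorphism
by the conjugacy classes of its local monodromies, and **cohomologically rigid** if its *index of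
rigidity* `rig(𝓕) = χ(ℙ¹, j_*End 𝓕) = (2 - r)·n² + Σ_i dim Z(A_i)` equals `2` (`n = rk 𝓕`, `A_i` the
local monodromy at `s_i`, `Z(A_i)` its centraliser in `M_n`).  His two structural results are

* [Katz1996, Thm. 1.1.2]: for `𝓕` irreducible, physically rigid ⟺ cohomologically rigid;
* [Katz1996, §5.2 (Thm. 5.2.1), Lemma 6.3.7] (the **existence algorithm**): every irreducible rigid
  `𝓕` is connected to a rank-one system by finitely many tensorings with rank-one systems and
  middle convolutions `MC_χ`.

Under the dictionary "local system on `𝔸¹ ∖ {t₁,…,t_r}` ↔ module `(T, V)` over the free group `F_r`"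
(Deligne; [Katz1996, Ch. 1]; [DettweilerReiter2000, Notation 2.1]) both become statements about
**tuples** `T = (T_r,…,T₁) ∈ GL_n(K)^r` with `T_∞ := T_r ⋯ T₁`, and Dettweiler–Reiter
[DettweilerReiter2000, §4] print and (re)prove them in exactly that form, over an arbitrary
algebraically closed field `K`, with Katz's `MC_χ` replaced by their convolution functor `MC_λ` — the
tree's `Literature.AlgebraicGeometry.Motives.middleConvolution` (`MiddleConvolution.lean`).  This file
vendors that printed tuple form:

* `RigidTuple.scalarMul ρ Λ = M_Λ(T) = (λ_r T_r, …, λ₁ T₁)` ([DettweilerReiter2000, Def. 4.8],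
  "multiplication"; Katz: tensoring with a rank-one local system);
* `RigidTuple.rigidityIndex ρ = Σ_{i<r} dim C_{End V}(T_i) + dim C(T_∞) - (r - 1)·n²` = Katz's index
  of rigidity `χ(ℙ¹, j_*End)` of the local system on `ℙ¹ ∖ {t₁,…,t_r,∞}` [Katz1996, Ch. 1]; on
  `T_∞ = 1` it is the printed `Σ_i dim C(T_i) - (r - 2)·n²` of [DettweilerReiter2000, Def. 4.3]
  (`rigidityIndex_eq_of_prodGenerators_eq_one`);
* `RigidTuple.IsLinearlyRigid ρ` ([DettweilerReiter2000, Def. 4.6]; = Katz's *physically rigid*,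
  Strambach–Völklein's *linearly rigid*): every tuple with `T'_i ∼ T_i` (all `i`) and `T'_∞ ∼ T_∞` is
  globally conjugate to `T`;
* `RigidTuple.ReducesToRankOne K r V ρ`: `(T, V)` "is connected to a tuple in `GL₁(K)` by an iterative
  application of multiplication and convolution" — the inductive closure of {rank one} under
  `M_Λ`-presteps and `MC_λ`-presteps (`λ ≠ 1`), as in [DettweilerReiter2000, Thm. 4.9] and its proof;
* the two theorems themselves, as NAMED FACTS (D-0014, statements only; section `NamedFacts` at the
  end of the file): `DettweilerReiter2000_lemma_4_7` — [DettweilerReiter2000, Lemma 4.7] (irreducible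
  `T` with `T_∞ = 1` over an algebraically closed field: linearly rigid ⟺ index of rigidity `= 2`;
  = [Katz1996, Thm. 1.1.2], Deligne–Simpson in characteristic `0`, Strambach–Völklein 1999 in
  general) — and `DettweilerReiter2000_thm_4_9` — [DettweilerReiter2000, Thm. 4.9] (= Katz's
  existence algorithm [Katz1996, §5.2 (Thm. 5.2.1), Lemma 6.3.7]: irreducible linearly rigid `T`
  with `T_∞ = 1` is connected to rank one by multiplications and convolutions) — which this
  vocabulary is made to state.

Dictionary with the tree's model (checked against [DettweilerReiter2000, Def. 2.2, Lemma 2.7]): a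
representation `ρ` of `FreeGroup (Fin r)` is the tuple WRITTEN `(ρ(f₀), ρ(f₁), …, ρ(f_{r-1}))`, i.e.
position `m : Fin r` is the `(m+1)`-st written entry `T_{r-m}` of `(T_r,…,T₁)`, and then
`T_∞ = T_r ∘ ⋯ ∘ T₁ = ρ (MiddleConvolution.prodGenerators r)`, and Dettweiler–Reiter's `C_λ`, `MC_λ` of
[DettweilerReiter2000, Def. 2.5] become, after the same relabelling of the coordinates of `V^r`, the
tree's `MiddleConvolution.convolution ρ λ`, `middleConvolution ρ λ` (the 2000 paper puts the factor
`λ` on the blocks to the right of the diagonal, the 2007 convention of the tree file on the blocks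
of smaller index; see the remark in `MiddleConvolution.lean`), with `𝒦 ↔ fixedVectors` and
`ℒ ≅ ker(λ T_∞ - 1)` ([DettweilerReiter2000, Lemma 2.7 (a)] ↔ `invariantsEquivKer`).

## Proved here
`scalarMul_of`, `scalarMul_one`, `centralizerDim_one`, `rigidityIndex_eq_of_prodGenerators_eq_one`
(agreement with [DettweilerReiter2000, Def. 4.3] on `T_∞ = 1`), `rigidityIndex_eq_two_of_finrank_eq_one`
(rank-one tuples have index of rigidity `2`, consistent with Lemma 4.7),
`ReducesToRankOne.of_finrank_eq_one`.

## Named facts (statements only, D-0014) — section `NamedFacts`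
* `DettweilerReiter2000_lemma_4_7`: `∀ K` algebraically closed, `V` finite-dimensional,
  `ρ : F_r → GL(V)` irreducible with `ρ(f₀⋯f_{r-1}) = 1`: `IsLinearlyRigid ρ ↔ rigidityIndex ρ = 2`
  ([DettweilerReiter2000, Lemma 4.7] = [Katz1996, Thm. 1.1.2]);
* `DettweilerReiter2000_thm_4_9`: same hypotheses, `IsLinearlyRigid ρ → ReducesToRankOne K r V ρ`
  ([DettweilerReiter2000, Thm. 4.9] = [Katz1996, Thm. 5.2.1 / Lemma 6.3.7]).
  Both are printed by Dettweiler–Reiter for tuples over the standing field `K` of their §4, which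
  their abstract, §4 introduction and Remark 4.10 take algebraically closed ("valid over any
  algebraically closed field"); the facts therefore assume `IsAlgClosed K` (only a weakening if `K`
  were allowed general), finite-dimensionality (their `Rep(K[F_r])`, Notation 2.1) and `T_∞ = 1`
  (Def. 4.3 defines the index only there; the proof of Thm. 4.9 starts "for any linearly rigid and
  irreducible tuple `T = (T_r,…,T₁)`, `T_∞ = 1`").  Edge cases `r ≤ 2` or `dim V = 1` are consistent:
  an irreducible tuple with `T_∞ = 1` and `r ≤ 2`, or of rank one, has index `2`
  (`rigidityIndex_eq_two_of_finrank_eq_one`), is linearly rigid, and is of rank one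
  (`ReducesToRankOne.rankOne`).

## NOT here (and why)
* [Katz1996, Thm. 8.4.1] (geometric / motivic realisation: an irreducible rigid `𝓕` with
  quasi-unipotent local monodromy is the `χ`-isotypic part of `Gr^W Rⁿπ_! ℚ̄_ℓ` for an explicit
  iterated cyclic-cover family with abelian group action) and [Dettweiler2008MC, Thm. 2.9 of the
  arXiv text, cited elsewhere as Thm. 2.6.1] (`W^{k₁}(𝓕₁) ⋆ W^{k₂}(𝓕₂) = W^{k₁+k₂+1}(𝓕₁ ⋆_naive 𝓕₂)`
  for `𝓕_i = P_i(R^{k_i}π_{i,!}E_λ)` cut out by idempotents of finite groups acting on families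
  `X_i → U_i`): these are SHEAF-level statements
  needing `Rⁿπ_!` with finite-group actions, weight filtrations and convolution of constructible
  sheaves on `𝔸¹`, none of which Mathlib or the tree has (the tree's `BettiHodgeData` /
  `GeometricVHSData` record only smooth projective families); not typable faithfully today.
* Scott's lemma [DettweilerReiter2000, Lemma 4.5], preservation of the index of rigidity under
  `MC_λ` [DettweilerReiter2000, Cor. 4.4] and the braid-group compatibility (§5) — not requested.
* No Mathlib notion of rigid tuple / index of rigidity exists (`lean search rigid|rigidity`: nothing
  relevant); conjugacy is Mathlib's `IsConj` / `SemiconjBy` in the monoid `Module.End K V` (whose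
  units are `GL(V)`), irreducibility is `Representation.IsIrreducible`.

## References
* N. M. Katz, *Rigid Local Systems*, Annals of Math. Studies 139, Princeton 1996, Thm. 1.1.2, §5.2,
  Lemma 6.3.7, Thm. 8.4.1 [Katz1996].
* M. Dettweiler, S. Reiter, *An algorithm of Katz and its application to the inverse Galois
  problem*, J. Symbolic Comput. 30 (2000) 761–798, Notation 2.1, Def. 2.2, 2.5, 4.3, 4.6, 4.8,
  Lemma 4.7, Thm. 4.9, Remark 4.10 [DettweilerReiter2000].
* M. Dettweiler, S. Reiter, *Middle convolution of Fuchsian systems …*, J. Algebra 318 (2007) 1–24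
  [DettweilerReiter2007] (the convention of `MiddleConvolution.lean`).
* M. Dettweiler, *On the middle convolution of local systems*, arXiv:0810.3334 [Dettweiler2008MC].
-/

noncomputable section

namespace Literature.AlgebraicGeometry.Motives

open MiddleConvolution Module

universe u v

namespace RigidTuple

section ScalarMul

variable {K : Type*} [Field K] {V : Type*} [AddCommGroup V] [Module K V] {ι : Type*}

/-- **Multiplication** `M_Λ(T) = (λ_r T_r, …, λ₁ T₁)` of a tuple by a tuple of invertible scalars
`Λ = (λ_i)_i` ([DettweilerReiter2000, Def. 4.8]); on local systems this is tensoring with the rank-one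
system of local monodromies `λ_i`.  As a representation of the free group: `f_i ↦ λ_i • ρ(f_i)`.
[cite: DettweilerReiter2000, Definition 4.8] -/
def scalarMul (ρ : Representation K (FreeGroup ι) V) (Λ : ι → Kˣ) :
    Representation K (FreeGroup ι) V :=
  (Units.coeHom (Module.End K V)).comp
    (FreeGroup.lift fun i =>
      Units.map (algebraMap K (Module.End K V)).toMonoidHom (Λ i) * ρ.asGroupHom (FreeGroup.of i))

/-- `M_Λ(T)_i = λ_i T_i`. [cite: DettweilerReiter2000, Definition 4.8] -/
@[simp]
theorem scalarMul_of (ρ : Representation K (FreeGroup ι) V) (Λ : ι → Kˣ) (i : ι) :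
    scalarMul ρ Λ (FreeGroup.of i) = (Λ i : K) • ρ (FreeGroup.of i) := by
  rw [Algebra.smul_def]
  simp [scalarMul, Representation.asGroupHom_apply]

/-- Multiplication by the trivial tuple of scalars is the identity. [folklore] -/
theorem scalarMul_one (ρ : Representation K (FreeGroup ι) V) : scalarMul ρ 1 = ρ := by
  refine FreeGroup.ext_hom _ _ fun i => ?_
  simp

end ScalarMul

section Index

variable {K : Type*} [Field K] {V : Type*} [AddCommGroup V] [Module K V]

/-- The dimension `dim C_{End(V)}(A)` of the centraliser of an endomorphism (`= dim Z(A)` in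
`M_n(K)`), the local term of Katz's index of rigidity. [folklore] -/
def centralizerDim (A : Module.End K V) : ℕ :=
  finrank K (Subalgebra.centralizer K ({A} : Set (Module.End K V)))

/-- **Index of rigidity** of a tuple `T = (T_r,…,T₁)` in `GL(V)` (`n = dim V`), i.e. of the local
system on `ℙ¹ ∖ {t₁,…,t_r,∞}` with local monodromies `T₁,…,T_r` and `T_∞ = T_r ⋯ T₁` at `∞`: Katz's
`rig = χ(ℙ¹, j_*End) = (2 - k)·n² + Σ_{s} dim Z(A_s)` over the `k = r + 1` punctures ([Katz1996, Ch. 1];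
the quantity in the numerical criterion [Katz1996, Thm. 1.1.2]), that is
`Σ_{i<r} dim C(T_i) + dim C(T_∞) - (r - 1)·n²`.
Dettweiler–Reiter print it only on the locus `T_∞ = 1` — verbatim [DettweilerReiter2000, Def. 4.3]:
"(Katz, 1996) Let `T` be an irreducible tuple in `GL_n(K)` such that `T_∞ = 1`. Then we call
`Σ_{i=1}^{r} dim(C_{Mat_n(K)}(T_i)) - (r - 2)n²` the index of rigidity." — and there the two agree
(`dim C(1) = n²`; `rigidityIndex_eq_of_prodGenerators_eq_one`); with the `∞`-term the integer is the
invariant of EVERY tuple that [DettweilerReiter2000, Cor. 4.4] ("the index of rigidity is preserved by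
application of the convolution", whose output has `T_∞ ≠ 1`) is about.
[cite: DettweilerReiter2000, Definition 4.3] -/
def rigidityIndex {r : ℕ} (ρ : Representation K (FreeGroup (Fin r)) V) : ℤ :=
  (∑ i, (centralizerDim (ρ (FreeGroup.of i)) : ℤ)) + (centralizerDim (ρ (prodGenerators r)) : ℤ) -
    ((r : ℤ) - 1) * (finrank K V : ℤ) ^ 2

/-- The centraliser of the identity is all of `End(V)`, of dimension `n²`. [folklore] -/
theorem centralizerDim_one [FiniteDimensional K V] :
    centralizerDim (1 : Module.End K V) = finrank K V ^ 2 := by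
  have htop : Subalgebra.centralizer K ({(1 : Module.End K V)} : Set (Module.End K V)) = ⊤ :=
    eq_top_iff.2 fun x _ => by
      rw [Subalgebra.mem_centralizer_iff]
      intro y hy
      rw [Set.mem_singleton_iff] at hy
      rw [hy, one_mul, mul_one]
  rw [centralizerDim, htop, ← Subalgebra.finrank_toSubmodule, Algebra.top_toSubmodule, finrank_top,
    Module.finrank_linearMap, sq]

/-- **On `T_∞ = 1` the index is Dettweiler–Reiter's printed expression**
`Σ_i dim C(T_i) - (r - 2)·n²` [DettweilerReiter2000, Def. 4.3]. [cite: DettweilerReiter2000, Definition 4.3] -/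
theorem rigidityIndex_eq_of_prodGenerators_eq_one [FiniteDimensional K V] {r : ℕ}
    (ρ : Representation K (FreeGroup (Fin r)) V) (h : ρ (prodGenerators r) = 1) :
    rigidityIndex ρ =
      (∑ i, (centralizerDim (ρ (FreeGroup.of i)) : ℤ)) - ((r : ℤ) - 2) * (finrank K V : ℤ) ^ 2 := by
  rw [rigidityIndex, h, centralizerDim_one]
  push_cast
  ring

/-- In rank one every centraliser is all of `End(V) ≅ K`. [folklore] -/
theorem centralizerDim_eq_one_of_finrank_eq_one (h : finrank K V = 1) (A : Module.End K V) :
    centralizerDim A = 1 := by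
  have hV : FiniteDimensional K V := Module.finite_of_finrank_eq_succ h
  unfold centralizerDim
  set S := Subalgebra.centralizer K ({A} : Set (Module.End K V))
  rw [← Subalgebra.finrank_toSubmodule]
  have hEnd : finrank K (Module.End K V) = 1 := by rw [Module.finrank_linearMap, h]
  have hle : finrank K (Subalgebra.toSubmodule S) ≤ 1 :=
    (Submodule.finrank_le (Subalgebra.toSubmodule S)).trans_eq hEnd
  have h1 : (1 : Module.End K V) ∈ Subalgebra.toSubmodule S := S.one_mem
  have h10 : (1 : Module.End K V) ≠ 0 := by
    haveI : Nontrivial V := Module.nontrivial_of_finrank_eq_succ h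
    exact one_ne_zero
  have hpos : 0 < finrank K (Subalgebra.toSubmodule S) := by
    haveI : Nontrivial (Subalgebra.toSubmodule S) :=
      ⟨⟨0, ⟨1, h1⟩, fun h0 => h10 (congrArg Subtype.val h0).symm⟩⟩
    exact Module.finrank_pos
  omega

/-- **Rank-one tuples have index of rigidity `2`** (`r·1 + 1 - (r - 1)·1 = 2`), consistent with
[DettweilerReiter2000, Lemma 4.7] (rank-one tuples are trivially linearly rigid). [folklore] -/
theorem rigidityIndex_eq_two_of_finrank_eq_one {r : ℕ} (ρ : Representation K (FreeGroup (Fin r)) V)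
    (h : finrank K V = 1) : rigidityIndex ρ = 2 := by
  unfold rigidityIndex
  rw [Finset.sum_congr rfl fun i _ =>
      congrArg (Nat.cast : ℕ → ℤ) (centralizerDim_eq_one_of_finrank_eq_one h (ρ (FreeGroup.of i))),
    centralizerDim_eq_one_of_finrank_eq_one h, Finset.sum_const, Finset.card_univ, Fintype.card_fin, h]
  simp only [Nat.cast_one, mul_one, one_pow]
  ring

end Index

section Rigid

variable {K : Type*} [Field K] {V : Type*} [AddCommGroup V] [Module K V]

/-- **Linearly rigid** tuple ([DettweilerReiter2000, Def. 4.6]; Katz's *physically rigid*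
[Katz1996, Ch. 1], in Strambach–Völklein's terminology): `T = (T_i)_i` in `GL(V)` is linearly rigid if
every other tuple `T'` in `GL(V)` with `T'_i` conjugate to `T_i` for all `i` AND `T'_∞` conjugate to
`T_∞` (`T_∞ = ρ(f₀ ⋯ f_{r-1})`, the product in the written order) is simultaneously conjugate to `T`:
there is `X ∈ GL(V)` with `X T_i = T'_i X` for all `i` (and then also `X T_∞ = T'_∞ X`).  Conjugacy is
Mathlib's `IsConj` / `SemiconjBy` in the monoid `End_K(V)`, whose units are `GL(V)`.
[cite: DettweilerReiter2000, Definition 4.6] -/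
def IsLinearlyRigid {r : ℕ} (ρ : Representation K (FreeGroup (Fin r)) V) : Prop :=
  ∀ ρ' : Representation K (FreeGroup (Fin r)) V,
    (∀ i, IsConj (ρ (FreeGroup.of i)) (ρ' (FreeGroup.of i))) →
    IsConj (ρ (prodGenerators r)) (ρ' (prodGenerators r)) →
      ∃ X : (Module.End K V)ˣ, ∀ i,
        SemiconjBy (X : Module.End K V) (ρ (FreeGroup.of i)) (ρ' (FreeGroup.of i))

end Rigid

/-- **"Connected to a tuple in `GL₁(K)` by an iterative application of multiplication and
convolution"** ([DettweilerReiter2000, Thm. 4.9]; Katz's existence algorithm [Katz1996, §5.2]): the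
smallest class of `F_r`-modules `(T, V)` containing every rank-one module and containing `(T, V)` as
soon as it contains some multiplication `M_Λ(T)` ([DettweilerReiter2000, Def. 4.8]) or some middle
convolution `MC_λ(T)` with `λ ≠ 1` (`middleConvolution`, [DettweilerReiter2000, Def. 2.5]) of it — the
intended reading is the Katz / Dettweiler–Reiter class (non-trivial `χ`, resp. the `λ ≠ 1` steps the
printed proof uses). [cite: DettweilerReiter2000, Theorem 4.9] -/
inductive ReducesToRankOne (K : Type u) [Field K] (r : ℕ) :
    ∀ (V : Type v) [AddCommGroup V] [Module K V], Representation K (FreeGroup (Fin r)) V → Prop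
  /-- Rank-one tuples are the targets. -/
  | rankOne {V : Type v} [AddCommGroup V] [Module K V] (ρ : Representation K (FreeGroup (Fin r)) V)
      (h : finrank K V = 1) : ReducesToRankOne K r V ρ
  /-- A multiplication step `T ↦ M_Λ(T)`. -/
  | mul {V : Type v} [AddCommGroup V] [Module K V] (ρ : Representation K (FreeGroup (Fin r)) V)
      (Λ : Fin r → Kˣ) (h : ReducesToRankOne K r V (scalarMul ρ Λ)) : ReducesToRankOne K r V ρ
  /-- A middle-convolution step `T ↦ MC_λ(T)` with `λ ≠ 1` (Katz's `MC_χ` needs a non-trivial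
  Kummer character `χ`; [DettweilerReiter2000, Def. 2.5] allows `λ = 1`, but `MC₁ ≅ id` under `(∗∗)`
  by [DettweilerReiter2000, Prop. 3.2], and the proof of [DettweilerReiter2000, Thm. 4.9] convolves
  only with `λ⁻¹ ≠ 1`, `λ = λ₁⋯λ_r ≠ 1` by Scott's lemma). -/
  | conv {V : Type v} [AddCommGroup V] [Module K V] (ρ : Representation K (FreeGroup (Fin r)) V)
      (l : Kˣ) (hl : (l : K) ≠ 1) (h : ReducesToRankOne K r (Space ρ l) (middleConvolution ρ l)) :
      ReducesToRankOne K r V ρ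

/-- Rank-one modules are (trivially) connected to rank one. [folklore] -/
theorem ReducesToRankOne.of_finrank_eq_one {K : Type u} [Field K] {r : ℕ} {V : Type v}
    [AddCommGroup V] [Module K V] (ρ : Representation K (FreeGroup (Fin r)) V)
    (h : finrank K V = 1) : ReducesToRankOne K r V ρ :=
  ReducesToRankOne.rankOne ρ h

end RigidTuple

/-! ### The two theorems of Katz's theory in tuple form (named facts) -/

section NamedFacts

open RigidTuple

/-- NAMED FACT — **Dettweiler–Reiter 2000, Lemma 4.7** (= Katz, *Rigid Local Systems*,
Thm. 1.1.2, "physically rigid ⟺ cohomologically rigid" for irreducible local systems; Deligne in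
Simpson 1990, Lemma 6, in characteristic `0`; Strambach–Völklein 1999 in general), verbatim: "An
irreducible tuple `T` in `GL_n(K)` is linearly rigid if and only if the index of rigidity is `2`."
Here (Def. 4.3) the index of rigidity `Σ_{i=1}^r dim C_{Mat_n(K)}(T_i) − (r − 2)n²` is defined for
irreducible `T` with `T_∞ = T_r ⋯ T₁ = 1`, and `K` is the algebraically closed ground field of
their §4 (abstract and Remark 4.10: "valid over any algebraically closed field").  Rendered in the
tuple model of this file: for `K` an algebraically closed field, `V` a finite-dimensional `K`-space,
`r : ℕ` and `ρ : F_r → GL(V)` (`Representation K (FreeGroup (Fin r)) V`, the tuple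
`(ρ f₀, …, ρ f_{r-1}) = (T_r, …, T₁)`) which is irreducible (`Representation.IsIrreducible`) with
`T_∞ = ρ(f₀ ⋯ f_{r-1}) = 1` (`prodGenerators`), `ρ` is linearly rigid (`IsLinearlyRigid`, Def. 4.6)
iff `rigidityIndex ρ = 2` (which on `T_∞ = 1` is the printed expression,
`rigidityIndex_eq_of_prodGenerators_eq_one`).  Users take `(h : DettweilerReiter2000_lemma_4_7)`.
[cite: DettweilerReiter2000, Lemma 4.7] -/
def DettweilerReiter2000_lemma_4_7 : Prop :=
  ∀ (K : Type u) [Field K] [IsAlgClosed K] (V : Type v) [AddCommGroup V] [Module K V]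
    [FiniteDimensional K V] (r : ℕ) (ρ : Representation K (FreeGroup (Fin r)) V),
    ρ.IsIrreducible → ρ (prodGenerators r) = 1 → (IsLinearlyRigid ρ ↔ rigidityIndex ρ = 2)

/-- NAMED FACT — **Dettweiler–Reiter 2000, Theorem 4.9** (= Katz's existence algorithm,
*Rigid Local Systems*, §5.2 (Thm. 5.2.1) and Lemma 6.3.7: "The following theorem is one of the main
results in Katz (1996, see Chapter 5.2 and Lemma 6.3.7)"), verbatim: "Any irreducible linearly
rigid tuple in `GL_n(K)` is connected to a tuple in `GL₁(K)` by an iterative application of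
multiplication and convolution."  Multiplication is `M_Λ` (Def. 4.8, `scalarMul`), convolution is
`MC_λ` (Def. 2.5, the tree's `middleConvolution` under the dictionary of the module docstring), `K`
is the algebraically closed ground field of §4, and the proof treats tuples with `T_∞ = 1`
("We show that for any linearly rigid and irreducible tuple `T = (T_r, …, T₁)`, `T_∞ = 1`, in
`GL_n(K)`, `n ≥ 2`, there are `λ_i ∈ Kˣ` such that `Σ rk(λ_i T_i − 1) < 2n` … By Scott's lemma
`λ := λ₁⋯λ_r ≠ 1`. Applying the convolution with `λ⁻¹` to `(λ_r T_r, …, λ₁ T₁)` we get a linearly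
rigid irreducible tuple in dimension `n' < n`"), so the connecting chain consists of
multiplications and of convolutions with parameters `≠ 1` — exactly the steps of
`ReducesToRankOne`.  Rendered: for `K` algebraically closed, `V` finite-dimensional, `ρ : F_r → GL(V)`
irreducible with `ρ(f₀ ⋯ f_{r-1}) = 1` and linearly rigid, `ReducesToRankOne K r V ρ`.  Users take
`(h : DettweilerReiter2000_thm_4_9)`. [cite: DettweilerReiter2000, Theorem 4.9] -/
def DettweilerReiter2000_thm_4_9 : Prop :=
  ∀ (K : Type u) [Field K] [IsAlgClosed K] (V : Type v) [AddCommGroup V] [Module K V]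
    [FiniteDimensional K V] (r : ℕ) (ρ : Representation K (FreeGroup (Fin r)) V),
    ρ.IsIrreducible → ρ (prodGenerators r) = 1 → IsLinearlyRigid ρ → ReducesToRankOne K r V ρ

/-- Hypothesis form of `DettweilerReiter2000_lemma_4_7`, in the direction used by Katz's algorithm:
an irreducible tuple with `T_∞ = 1` and index of rigidity `2` is linearly rigid.
[cite: DettweilerReiter2000, Lemma 4.7] -/
theorem DettweilerReiter2000_lemma_4_7.isLinearlyRigid (h : DettweilerReiter2000_lemma_4_7.{u, v})
    {K : Type u} [Field K] [IsAlgClosed K] {V : Type v} [AddCommGroup V] [Module K V]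
    [FiniteDimensional K V] {r : ℕ} {ρ : Representation K (FreeGroup (Fin r)) V}
    (hirr : ρ.IsIrreducible) (h1 : ρ (prodGenerators r) = 1) (hind : rigidityIndex ρ = 2) :
    IsLinearlyRigid ρ :=
  (h K V r ρ hirr h1).2 hind

/-- **Katz's algorithm from the numerical criterion**: under both named facts, an irreducible tuple
with `T_∞ = 1` and index of rigidity `2` over an algebraically closed field is connected to rank one
by multiplications and convolutions ([DettweilerReiter2000, Lemma 4.7 with Thm. 4.9]; Katz's
"cohomologically rigid irreducibles are built from rank one by `MC_χ` and tensoring").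
[cite: DettweilerReiter2000, Theorem 4.9] -/
theorem DettweilerReiter2000_thm_4_9.of_rigidityIndex_eq_two (h : DettweilerReiter2000_thm_4_9.{u, v})
    (h' : DettweilerReiter2000_lemma_4_7.{u, v}) {K : Type u} [Field K] [IsAlgClosed K] {V : Type v}
    [AddCommGroup V] [Module K V] [FiniteDimensional K V] {r : ℕ}
    {ρ : Representation K (FreeGroup (Fin r)) V} (hirr : ρ.IsIrreducible)
    (h1 : ρ (prodGenerators r) = 1) (hind : rigidityIndex ρ = 2) : ReducesToRankOne K r V ρ :=
  h K V r ρ hirr h1 (h'.isLinearlyRigid hirr h1 hind)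

end NamedFacts

end Literature.AlgebraicGeometry.Motives

end
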